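import Summits.AtomisticToContinuum.Crystallization.Theorems.ChartedZeroExcessLayeredLatticeLiouvilleZD

/-!
# Part ZE «CapLemma» (lens-2 g77 rider 2; the LETTER-BOOKKEEPING half of g78's ruled target, critic row 1377 (iv))

Configuration-free, `decide`-scale.  DICTIONARY with the tree's Barlow stacking (`Literature…BarlowStacking`:
`barlowPos k i j = i•u + j•v + (haggLabel s k)•w + k•h e₃`, `w = (u+v)/3`): give each sheet its own Löschian coordinates
`(i, j)`; the Hägg letter `s k = +1` (`τ = true`, "up") resp. `−1` (`τ = false`, "down") of the step from sheet `k` to sheet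
`k+1` decides which lower sites an upper site `q` is bonded to: `q + triVert τ i`, `i : Fin 3` — the "up" triangle
`{q, q+u, q+v}` resp. the "down" triangle `{q, q−u, q−v}` (`|Δ + s_k w|² = a²/3`; cf. ZC-2b's hollow cosets `p + b` / `p + 2b`).

* `triVert`, `CrossAdj τ p q` (lower site `p` bonded to upper site `q` across a step of letter `τ`).
* `capType j ε τ`, `capShift j ε τ` and ★ `loRot_triVert` / `loRot_triVert'`: the point-group map `loRot j ε` carries the
  letter-`τ` triangle onto a translate (`capShift`) of the letter-`capType` triangle; `capType j ε τ = τ` iff `loRot j ε`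
  preserves triangle parity (the index-2 subgroup `D₃ ≤ D₆`).
* `triVert_sub_triVert` — a triangle contained in a triangle is that triangle (translation `0`, same letter).
* ★★ `cap_forcing` — if the lower sheet carries the affine map `p ↦ a + loRot j ε p` and an upper site's image is bonded (letter
  `τ'`) to the images of its three lower neighbours (letter `τ`), then `τ' = capType j ε τ` AND the image is
  `a + capShift j ε τ + loRot j ε q`: the upper sheet's affine map is FORCED — same linear part, translation shifted by
  `capShift`, letters related by `capType`.  ★★ `sheet_lift` — the region form.  `crossAdj_lift` — conversely the forced map
  does preserve the cross bonds (so the inward continuation of (GL) is consistent).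

With ZD (`lattice_rigidity`: in-sheet) this completes the configuration-free skeleton of (GL) `BondLabelP` (NODE 77): what
remains is bookkeeping against the chart `Φ` of `IsCharted` (memo §6 (L1), (L2), (L4)).  0 sorry; standard axioms.
-/

namespace Summit.AtomisticToContinuum.Crystallization.Theorems.ChartedZeroExcessLayeredLatticeLiouville

/-! ### ZE-1  Cross-sheet bonds in Löschian coordinates -/

/-- The three lower neighbours of an upper site, relative to it: the "up" triangle `{0, u, v}` for letter `+1` (`true`),
the "down" triangle `{0, −u, −v}` for letter `−1` (`false`). -/
def triVert (τ : Bool) (i : Fin 3) : ℤ × ℤ :=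
  if τ then ![((0 : ℤ), (0 : ℤ)), (1, 0), (0, 1)] i else ![((0 : ℤ), (0 : ℤ)), (-1, 0), (0, -1)] i

/-- Lower site `p` (sheet `k`) is bonded to upper site `q` (sheet `k+1`) across a step of letter `τ`. -/
def CrossAdj (τ : Bool) (p q : ℤ × ℤ) : Prop := ∃ i : Fin 3, p = q + triVert τ i

/-- `triVert_zero` (docstring added by the landing lane; see the module docstring). [formal bookkeeping] -/
theorem triVert_zero (τ : Bool) : triVert τ 0 = 0 := by
  cases τ <;> rfl

/-- `crossAdj_self` (docstring added by the landing lane; see the module docstring). [formal bookkeeping] -/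
theorem crossAdj_self (τ : Bool) (q : ℤ × ℤ) : CrossAdj τ q q :=
  ⟨0, by rw [triVert_zero, add_zero]⟩

/-! ### ZE-2  How the twelve point-group maps act on the letter triangles -/

/-- The index `m` with `loRot j ε {0, loDir 0, loDir 1} = {0, loDir m, loDir (m+1)}`. -/
def capIndex (j : Fin 6) (ε : Bool) : Fin 6 := if ε then j else j - 1

/-- The letter of the image triangle: parity of the "up" triangle is kept iff `capIndex` is even. -/
def capType (j : Fin 6) (ε : Bool) (τ : Bool) : Bool :=
  if (capIndex j ε).val % 2 = 0 then τ else !τ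

/-- The translation of the image triangle. -/
def capShift (j : Fin 6) (ε : Bool) (τ : Bool) : ℤ × ℤ :=
  if τ then ![((0 : ℤ), (0 : ℤ)), (0, 1), (-1, 0), (0, 0), (0, -1), (1, 0)] (capIndex j ε)
  else ![((0 : ℤ), (0 : ℤ)), (0, -1), (1, 0), (0, 0), (0, 1), (-1, 0)] (capIndex j ε)

/-- ★ The point-group map `loRot j ε` carries the letter-`τ` triangle onto `capShift + ` the letter-`capType` triangle
(vertex by vertex, forward direction). -/
theorem loRot_triVert (j : Fin 6) (ε τ : Bool) (i : Fin 3) :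
    ∃ i' : Fin 3, loRot j ε (triVert τ i) = capShift j ε τ + triVert (capType j ε τ) i' := by
  revert j ε τ i; decide

/-- ★ The same, backward direction (every vertex of the image triangle is hit). -/
theorem loRot_triVert' (j : Fin 6) (ε τ : Bool) (i' : Fin 3) :
    ∃ i : Fin 3, loRot j ε (triVert τ i) = capShift j ε τ + triVert (capType j ε τ) i' := by
  revert j ε τ i'; decide

/-- `capType j ε τ = τ` iff `loRot j ε` lies in the parity-preserving subgroup (rotations by multiples of `120°` and the three
reflections in axes through hollows); recorded as the explicit table. -/
theorem capType_eq_self_iff (j : Fin 6) (ε τ : Bool) : capType j ε τ = τ ↔ (capIndex j ε).val % 2 = 0 := by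
  revert j ε τ; decide

/-! ### ZE-3  Forcing -/

/-- A letter triangle containing a translate of a letter triangle: the translation is `0` and the letters agree. -/
theorem triVert_sub_triVert (z : ℤ × ℤ) (τ τ' : Bool)
    (h : ∀ i : Fin 3, ∃ i' : Fin 3, z + triVert τ i = triVert τ' i') : z = 0 ∧ τ = τ' := by
  obtain ⟨i₀, h₀⟩ := h 0
  rw [triVert_zero, add_zero] at h₀
  subst h₀
  revert τ τ' i₀
  decide

/-- ★★ **CAP FORCING.**  Lower sheet affine (`p ↦ a + loRot j ε p`); an upper site `q` whose image `y` is bonded, across a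
step of letter `τ'`, to the images of its three lower neighbours (letter `τ`).  Then the letters are related by `capType` and
`y` is forced. -/
theorem cap_forcing (a q y : ℤ × ℤ) (j : Fin 6) (ε τ τ' : Bool)
    (h : ∀ i : Fin 3, CrossAdj τ' (a + loRot j ε (q + triVert τ i)) y) :
    τ' = capType j ε τ ∧ y = a + capShift j ε τ + loRot j ε q := by
  have key : ∀ i₂ : Fin 3, ∃ i' : Fin 3,
      (a + loRot j ε q + capShift j ε τ - y) + triVert (capType j ε τ) i₂ = triVert τ' i' := by
    intro i₂
    obtain ⟨i, hi⟩ := loRot_triVert' j ε τ i₂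
    obtain ⟨i', hi'⟩ := h i
    refine ⟨i', ?_⟩
    rw [loRot_add, hi] at hi'
    -- hi' : a + (loRot j ε q + (capShift j ε τ + triVert (capType j ε τ) i₂)) = y + triVert τ' i'
    have := congrArg (fun x => x - y) hi'
    simp only [add_sub_cancel_left] at this
    rw [← this]; abel
  obtain ⟨hz, hτ⟩ := triVert_sub_triVert _ _ _ key
  refine ⟨hτ.symm, ?_⟩
  rw [sub_eq_zero] at hz
  rw [← hz]; abel

/-- ★★ **SHEET LIFT (region form).**  If `G` is affine on a lower region `P`, `Q` is a set of upper sites whose three lower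
neighbours lie in `P`, and `(G, G')` preserves the cross bonds from `P` to `Q` (letters `τ` in the source, `τ'` in the target),
then `G'` is affine on `Q` with the SAME linear part and translation `a + capShift j ε τ`; and if `Q` is inhabited the letters
satisfy `τ' = capType j ε τ`. -/
theorem sheet_lift (G G' : ℤ × ℤ → ℤ × ℤ) (P Q : Set (ℤ × ℤ)) (a : ℤ × ℤ) (j : Fin 6) (ε τ τ' : Bool)
    (hG : ∀ p ∈ P, G p = a + loRot j ε p)
    (hQ : ∀ q ∈ Q, ∀ i : Fin 3, q + triVert τ i ∈ P)
    (hX : ∀ p ∈ P, ∀ q ∈ Q, CrossAdj τ p q → CrossAdj τ' (G p) (G' q)) :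
    (∀ q ∈ Q, G' q = (a + capShift j ε τ) + loRot j ε q) ∧ (Q.Nonempty → τ' = capType j ε τ) := by
  have main : ∀ q ∈ Q, τ' = capType j ε τ ∧ G' q = a + capShift j ε τ + loRot j ε q := by
    intro q hq
    apply cap_forcing a q (G' q) j ε τ τ'
    intro i
    have hb := hX _ (hQ q hq i) q hq ⟨i, rfl⟩
    rwa [hG _ (hQ q hq i)] at hb
  exact ⟨fun q hq => (main q hq).2, fun ⟨q, hq⟩ => (main q hq).1⟩

/-- CONSISTENCY.  Conversely, the forced pair of affine maps preserves every cross bond (so the inward continuation sheet by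
sheet in (GL) is bond-preserving by construction). -/
theorem crossAdj_lift (a p q : ℤ × ℤ) (j : Fin 6) (ε τ : Bool) (h : CrossAdj τ p q) :
    CrossAdj (capType j ε τ) (a + loRot j ε p) ((a + capShift j ε τ) + loRot j ε q) := by
  obtain ⟨i, rfl⟩ := h
  obtain ⟨i', hi'⟩ := loRot_triVert j ε τ i
  exact ⟨i', by rw [loRot_add, hi']; abel⟩

/-- The lifted map is again of point-group-affine form with the same linear part, so ZD's in-sheet lemmas apply to it
unchanged (e.g. it preserves in-sheet bonds). -/
theorem loAdj_lift (a : ℤ × ℤ) (j : Fin 6) (ε τ : Bool) {q q' : ℤ × ℤ} (h : LoAdj q q') :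
    LoAdj ((a + capShift j ε τ) + loRot j ε q) ((a + capShift j ε τ) + loRot j ε q') := by
  obtain ⟨k, hk⟩ := loAdj_loRot j ε h
  exact ⟨k, by rw [hk]; abel⟩

end Summit.AtomisticToContinuum.Crystallization.Theorems.ChartedZeroExcessLayeredLatticeLiouville
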